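import Summits.CriticalPhenomena.PercolationContinuityZ3.Theorems.PercNearOneGluingAdditiveGluingGnegCore
import Literature.Probability.Percolation.TwoClusterConditionalAssociation
import HarnessLib

/-!
# Crux `PercNearOneGluing.AdditiveGluing` (stmt-CriticalPhenomena-4576), line `subuniform-dead-pocket-maximum`
# — a DECORATED van den Berg–Häggström–Kahn inequality, III: the measure form NEG

Helper file for the crux (siege seat k17, stub `stub_goodStep`, variation "C1 kernel first"); lands
with `--supports stmt-CriticalPhenomena-4576`.  No new definitions.

**NEG.**  For the product Bernoulli measure `μ = prodBernoulli w` on bond configurations of a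
finite vertex type, vertices `o, g, s, b` and ANY family `𝓡` of vertex sets, with
`Q := {s ∈ C(o)} ∪ {C(o) ∈ 𝓡, g ∉ C(o)}` (`C(o) = openCluster ω o`) and `D := {g ↮ s}`:

  `μ(g ↔ b, Q, D) · μ(D) ≤ μ(g ↔ b, D) · μ(Q ∩ D)`,

i.e. GIVEN `g ↮ s`, the connection `{g ↔ b}` is NEGATIVELY correlated with every event of the
cluster of `o` squeezed between `{o ↔ s}` and `{o ↮ g}`.  `Q = {o ↔ s}` is BHK 2006 Thm 1.5 /
Kozma–Nitzan's use of it in Lemma 3(i) (arXiv:2401.12397 p. 6); `Q = {o ↮ g}` is BHK Thm 1.3; the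
general `Q` ("adversarial dead-pocket selection") is what lead c1's kernel conjecture C1 needs.
Obtained from the finite-sum `gneg_core` (file II) with `U = univ`, `X = Y = {s}`,
`F = connIndicatorFn g b`, `q_X(K) = 1{K ∩ X ≠ ∅ ∨ (K ∈ 𝓡 ∧ g ∉ K)}`, after identifying
`prodBernoulli w` with the finite weighted sum (`BHK2006.integral_prodBernoulli_eq_sum`).
-/

namespace Summit.CriticalPhenomena.PercolationContinuityZ3.Theorems

open MeasureTheory Literature.Probability.Percolation Literature.Probability.Percolation.BHK2006
open DecisionTree
open Literature.Probability.LatticeModels (prodBernoulli)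
open scoped Classical

variable {V : Type*} [Fintype V]

/-- **NEG — negative conditional correlation of `{g ↔ b}` with a squeezed pocket event.**
For `μ = prodBernoulli w`, `Q = {s ∈ C(o)} ∪ {C(o) ∈ 𝓡, g ∉ C(o)}`, `D = {g ↮ s}`:
`μ({g↔b} ∩ Q ∩ D) μ(D) ≤ μ({g↔b} ∩ D) μ(Q ∩ D)`. [this project; `𝓡 = ∅`: BHK 2006 Thm 1.5] -/
theorem gneg_neg (w : Sym2 V → unitInterval) (o g s b : V) (𝓡 : Set (Set V)) :
    (prodBernoulli w).real (openConn g b ∩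
        {ω | s ∈ openCluster ω o ∨ (openCluster ω o ∈ 𝓡 ∧ g ∉ openCluster ω o)} ∩ (openConn g s)ᶜ) *
      (prodBernoulli w).real (openConn g s : Set (BondConfig V))ᶜ ≤
    (prodBernoulli w).real (openConn g b ∩ (openConn g s)ᶜ) *
      (prodBernoulli w).real
        ({ω | s ∈ openCluster ω o ∨ (openCluster ω o ∈ 𝓡 ∧ g ∉ openCluster ω o)} ∩ (openConn g s)ᶜ) := by
  set Q : Set (BondConfig V) :=
    {ω | s ∈ openCluster ω o ∨ (openCluster ω o ∈ 𝓡 ∧ g ∉ openCluster ω o)} with hQ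
  set D : Set (BondConfig V) := (openConn g s)ᶜ with hD
  set w' : Sym2 V → ℝ := fun e => (w e : ℝ) with hw'
  have hw0 : ∀ e, 0 ≤ w' e := fun e => (w e).2.1
  have hw1 : ∀ e, w' e ≤ 1 := fun e => (w e).2.2
  -- `μ(S)` as a finite weighted sum (as in the tree's proof of BHK Thm 1.3)
  have hreal : ∀ S : Set (Set (Sym2 V)), (prodBernoulli w).real S = ∑ ω, weight w' ω * ind S ω :=
    fun S => by
      rw [← integral_indicator_one (MeasurableSet.of_discrete (s := S)),
        integral_prodBernoulli_eq_sum]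
      refine Finset.sum_congr rfl fun ω _ => ?_
      by_cases hω : ω ∈ S
      · rw [Set.indicator_of_mem hω, ind_of_mem hω, Pi.one_apply]
      · rw [Set.indicator_of_notMem hω, ind_of_not_mem hω, mul_zero]
  have hm : ∑ ω, weight w' ω = 1 := by
    have h1 := integral_prodBernoulli_eq_sum w fun _ => (1 : ℝ)
    simp only [integral_const, probReal_univ, smul_eq_mul, mul_one] at h1
    exact h1.symm
  -- the decoration
  set q : Set V → Set V → ℝ := fun X K =>
    if (∃ x ∈ X, x ∈ K) ∨ (K ∈ 𝓡 ∧ g ∉ K) then 1 else 0 with hq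
  have hq0 : ∀ X K, 0 ≤ q X K := fun X K => by
    simp only [hq]; split_ifs <;> norm_num
  have hq1 : ∀ X K, q X K ≤ 1 := fun X K => by
    simp only [hq]; split_ifs <;> norm_num
  have hqX : ∀ X K, (∃ x ∈ X, x ∈ K) → q X K = 1 := fun X K h => by
    simp only [hq]; rw [if_pos (Or.inl h)]
  have hqe : ∀ X K, (∀ x ∈ X, x ∉ K) → q X K = q ∅ K := fun X K h => by
    have h1 : ¬ ∃ x ∈ X, x ∈ K := fun ⟨x, hx, hxK⟩ => h x hx hxK
    have h2 : ¬ ∃ x ∈ (∅ : Set V), x ∈ K := fun ⟨x, hx, _⟩ => hx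
    simp only [hq, h1, h2, false_or]
  have hqg : ∀ K, g ∈ K → q ∅ K = 0 := fun K hgK => by
    have h2 : ¬ ∃ x ∈ (∅ : Set V), x ∈ K := fun ⟨x, hx, _⟩ => hx
    simp only [hq, h2, false_or]
    rw [if_neg fun h => h.2 hgK]
  -- GNEG with `U = univ`, `X = Y = {s}`
  have hsub : ({s} : Set V) ⊆ ↑(Finset.univ : Finset V) := by simp
  have key := gneg_core w' hw0 hw1 hm o g (connIndicatorFn g b) (monotone_connIndicatorFn g b)
    (fun C => by unfold connIndicatorFn; split_ifs <;> norm_num) q hq0 hq1 hqX hqe hqg Finset.univ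
    (Finset.mem_univ o) (Finset.mem_univ g) {s} {s} hsub hsub
  rw [Set.inter_self, Set.union_self] at key
  -- `U = univ`: the restricted quantities are the original ones
  have hE : ∀ ω : Set (Sym2 V), ω ∩ edgesIn (Finset.univ : Finset V) = ω := fun ω => by
    ext e
    simp only [Set.mem_inter_iff, edgesIn, Set.mem_setOf_eq, Finset.mem_univ, imp_true_iff,
      and_true]
  have hC : ∀ ω, rC Finset.univ g ω = openEdgeCluster ω g := fun ω => by simp only [rC, hE]
  have hDD : rD Finset.univ g ({s} : Set V) = D := by
    ext ω
    simp only [rD, hE, hD, Set.mem_setOf_eq, Set.mem_singleton_iff, forall_eq, Set.mem_compl_iff]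
    rfl
  have hK : ∀ ω : Set (Sym2 V), openCluster (ω ∩ edgesIn (Finset.univ : Finset V)) o =
      openCluster ω o := fun ω => by rw [hE]
  -- the three indicators
  have hF : ∀ ω, connIndicatorFn g b (openEdgeCluster ω g) = ind (openConn g b) ω := fun ω => by
    rw [connIndicatorFn_openEdgeCluster]
    by_cases h : ω ∈ openConn g b
    · rw [Set.indicator_of_mem h, ind_of_mem h, Pi.one_apply]
    · rw [Set.indicator_of_notMem h, ind_of_not_mem h]
  have hqQ : ∀ ω : Set (Sym2 V), q {s} (openCluster ω o) = ind Q ω := fun ω => by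
    have e : (∃ x ∈ ({s} : Set V), x ∈ openCluster ω o) ↔ s ∈ openCluster ω o := by simp
    by_cases h : ω ∈ Q
    · rw [ind_of_mem h]; simp only [hq]; rw [if_pos]; rw [e]; exact h
    · rw [ind_of_not_mem h]; simp only [hq]; rw [if_neg]; rw [e]; exact h
  simp only [hC, hDD, hK, hF, hqQ] at key
  simp_rw [← ind_inter] at key
  rw [← hreal, ← hreal, ← hreal, ← hreal] at key
  exact key

/-- **Registered sub-goal `stub_gnegNeg_k17`** (siege k17): NEG, the measure form of the decorated
BHK inequality (closed form of `gneg_neg`, vertex type in `Type`). [this project] -/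
theorem stub_gnegNeg_k17 : ∀ (V : Type) [Fintype V] (w : Sym2 V → unitInterval) (o g s b : V) (𝓡 : Set (Set V)), (prodBernoulli w).real (openConn g b ∩ {ω | s ∈ openCluster ω o ∨ (openCluster ω o ∈ 𝓡 ∧ g ∉ openCluster ω o)} ∩ (openConn g s)ᶜ) * (prodBernoulli w).real (openConn g s : Set (BondConfig V))ᶜ ≤ (prodBernoulli w).real (openConn g b ∩ (openConn g s)ᶜ) * (prodBernoulli w).real ({ω | s ∈ openCluster ω o ∨ (openCluster ω o ∈ 𝓡 ∧ g ∉ openCluster ω o)} ∩ (openConn g s)ᶜ) :=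
  fun _ _ w o g s b 𝓡 => gneg_neg w o g s b 𝓡

end Summit.CriticalPhenomena.PercolationContinuityZ3.Theorems
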